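import Mathlib
import Summits.NavierStokesRegularity.FluidComputer.TriadSignGeometry
import HarnessLib

/-!
# The triad gate dictionary: which of Tao's quadratic gates a single TRUE Navier–Stokes helical
# triad can emulate, and at what price (locked pairs, Manley–Rowe memory)

HONEST FRAMING (cell `ns-blowup`, seat `ns-blowup-circuit`, human ruling D-0035): this cell
ATTEMPTS the negative direction of the Clay problem; nothing in this file is a claim about
Navier–Stokes blow-up. MODEL-side elementary real algebra / ODE identities about ONE helical
sub-triad (Waleffe 1992) on its real-phase branch; not a statement about the Navier–Stokes
equations. Companion of `TriadSignGeometry` (pub-fluidc bp2) and of the memo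
`run/shared/lean/pub/ns-blowup/CIRCUIT-OBSTRUCTIONS.md` §B.4 (seat ns-blowup-circuit).

SETTING. One helical sub-triad with moduli `k p q > 0`, signs `sk sp sq ∈ {±1}` and the fixed
interaction pattern `(Ck, Cp, Cq) = (sq·q − sp·p, sk·k − sq·q, sp·p − sk·k)` of
`TriadSignGeometry` [cite: Waleffe1992, §II]. On the real-phase branch (triad phase `0` or `π`,
invariant) the amplitudes obey `rk' = a·rp·rq, rp' = b·rq·rk, rq' = c·rk·rp` with
`(a, b, c) = g·(Ck, Cp, Cq)`, `a + b + c = 0`. Tao's gates [cite: Tao2016AveragedNS, §5.1–5.4]: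
pump `ẋ = −αxy, ẏ = αx²`; amplifier `ẋ = −αy², ẏ = αxy`; rotor `ẋ = −αyz, ẏ = αxz, ż = 0`.
A single wavevector pair `{±k}` has no self-interaction, so NS has NO binary gate: a binary Tao
gate must be emulated by a triad with one leg doubled — a LOCKED PAIR of legs with EQUAL pattern
coefficients carrying equal amplitudes.

WHAT IS TYPED.
* `locked_pair_iff`, `locked_pair_third` — `Ck = Cp ↔ 2·sq·q = sk·k + sp·p`, and then `Cq = −2·Ck`.
* `locked_pair_geometry` — with unit signs, positive moduli, the triangle inequalities of
  `k + p + q = 0` and `Ck = Cp ≠ 0`: the pair is HOMOCHIRAL with the third leg (`sk = sp = sq`),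
  `2q = k + p` and `k ≠ p`; `locked_pair_target_between` — hence `min k p < q < max k p`: a locked
  pump never feeds a strictly larger (or smaller) wavenumber than both sources.
* `manley_rowe` — along the real triad ODE, `b·rk² − a·rp²` is conserved (Manley–Rowe).
* `lock_splitting`, `lock_splitting_sq_nonneg` — for a locked pair (`a = b`) the splitting
  `δ = rk − rp` obeys `δ' = −a·rq·δ`; while the gate pumps FORWARD (`a ≤ 0 ≤ rq`) `δ²` is
  non-decreasing: the lock is not attracting, and by `manley_rowe` (`a(rk² − rp²)` conserved) an
  unlocked pump never completes — the residual `|rk² − rp²|` stays in the sources.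
* `locked_pump` — on the lock `rk = rp`, `x = √2·rk`, `y = rq` obey Tao's pump with `α = −a`.
* `locked_amplifier_splitting` — for the amplifier topology (single leg `x = rq`, locked pair
  `(rk, rp)` as OUTPUT, growth when `a·rq > 0`) the splitting obeys the same law `δ' = −a·rq·δ`,
  now with `a·rq ≥ 0`: `δ²` is non-increasing (the amplifier's lock IS attracting).
* `rotor_invariants` — apex catalyst (`c = 0`, `b = −a`): `rq` and `rk² + rp²` are conserved —
  Tao's rotor exactly (`TriadSignGeometry.apex_silent_iff` says when `c = 0`).

HONEST LIMITS: statements about ONE sub-triad on its real-phase branch; compound gates, phase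
dynamics off the branch, and packets (memo §B.1–B.3) are not treated; nothing about Navier–Stokes.
-/

namespace Summit.NavierStokesRegularity.FluidComputer.TriadGateDictionary

open Summit.NavierStokesRegularity.FluidComputer.TriadSignGeometry

/-! ## Static part: the locked-pair condition on the Waleffe pattern -/

section Static
variable (sk sp sq k p q : ℝ)

/-- Two legs `k, p` of a sub-triad carry EQUAL pattern coefficients iff `2·sq·q = sk·k + sp·p`. -/
theorem locked_pair_iff : Ck sk sp sq k p q = Cp sk sp sq k p q ↔ 2 * sq * q = sk * k + sp * p := by
  unfold Ck Cp; constructor <;> intro h <;> linarith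

/-- If `Ck = Cp` then the third coefficient is `Cq = -2·Ck` (energy conservation of the pattern). -/
theorem locked_pair_third (h : Ck sk sp sq k p q = Cp sk sp sq k p q) :
    Cq sk sp sq k p q = -2 * Ck sk sp sq k p q := by
  have := pattern_energy sk sp sq k p q
  linarith

/-- **Geometry of a locked pair.** For unit signs, positive moduli obeying the triangle
inequalities of a closed triad, and a non-silent locked pair `Ck = Cp ≠ 0`: all three legs are
HOMOCHIRAL, the third modulus is the mean of the pair's, and the pair's moduli differ. -/
theorem locked_pair_geometry (hk : 0 < k) (hp : 0 < p) (hq : 0 < q)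
    (tk : k ≤ p + q) (tp : p ≤ q + k)
    (hsk : sk = 1 ∨ sk = -1) (hsp : sp = 1 ∨ sp = -1) (hsq : sq = 1 ∨ sq = -1)
    (hlock : Ck sk sp sq k p q = Cp sk sp sq k p q) (hne : Ck sk sp sq k p q ≠ 0) :
    sk = sp ∧ sq = sk ∧ 2 * q = k + p ∧ k ≠ p := by
  have h2 := (locked_pair_iff sk sp sq k p q).mp hlock
  unfold Ck at hne
  rcases hsk with rfl | rfl <;> rcases hsp with rfl | rfl <;> rcases hsq with rfl | rfl <;>
    refine ⟨by linarith, by linarith, by linarith, ?_⟩ <;> intro hkp <;> apply hne <;> linarith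

/-- Hence a locked pump feeds a wavenumber strictly BETWEEN its two sources. -/
theorem locked_pair_target_between (hk : 0 < k) (hp : 0 < p) (hq : 0 < q)
    (tk : k ≤ p + q) (tp : p ≤ q + k)
    (hsk : sk = 1 ∨ sk = -1) (hsp : sp = 1 ∨ sp = -1) (hsq : sq = 1 ∨ sq = -1)
    (hlock : Ck sk sp sq k p q = Cp sk sp sq k p q) (hne : Ck sk sp sq k p q ≠ 0) :
    min k p < q ∧ q < max k p := by
  obtain ⟨_, _, h2q, hkp⟩ :=
    locked_pair_geometry sk sp sq k p q hk hp hq tk tp hsk hsp hsq hlock hne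
  rcases lt_or_gt_of_ne hkp with h | h
  · rw [min_eq_left h.le, max_eq_right h.le]; constructor <;> linarith
  · rw [min_eq_right h.le, max_eq_left h.le]; constructor <;> linarith

end Static

/-! ## Dynamic part: the real-phase triad ODE `rk' = a rp rq, rp' = b rq rk, rq' = c rk rp` -/

section Dynamic
variable {rk rp rq : ℝ → ℝ} {a b c t : ℝ}

/-- **Manley–Rowe.** Along the real triad ODE, `b·rk² − a·rp²` is conserved. -/
theorem manley_rowe (hk : HasDerivAt rk (a * rp t * rq t) t) (hp : HasDerivAt rp (b * rq t * rk t) t) :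
    HasDerivAt (fun s => b * rk s ^ 2 - a * rp s ^ 2) 0 t := by
  refine (((hk.pow 2).const_mul b).sub ((hp.pow 2).const_mul a)).congr_deriv ?_
  try simp only [Nat.cast_ofNat, Nat.reduceSub, pow_one]
  ring

/-- **Splitting law of a locked pair** (`a = b`): `δ = rk − rp` obeys `δ' = −a·rq·δ`. -/
theorem lock_splitting (hk : HasDerivAt rk (a * rp t * rq t) t)
    (hp : HasDerivAt rp (a * rq t * rk t) t) :
    HasDerivAt (fun s => rk s - rp s) (-(a * rq t) * (rk t - rp t)) t :=
  (hk.sub hp).congr_deriv (by ring)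

/-- While a locked PUMP runs forward (`a ≤ 0 ≤ rq`, i.e. the odd leg `rq` gains since
`rq' = −2a·rk·rp`), the squared splitting `δ²` has non-negative derivative: the lock is not
attracting. -/
theorem lock_splitting_sq_nonneg (hk : HasDerivAt rk (a * rp t * rq t) t)
    (hp : HasDerivAt rp (a * rq t * rk t) t) (ha : a ≤ 0) (hq : 0 ≤ rq t) :
    HasDerivAt (fun s => (rk s - rp s) ^ 2) (-2 * a * rq t * (rk t - rp t) ^ 2) t ∧
      0 ≤ -2 * a * rq t * (rk t - rp t) ^ 2 := by
  refine ⟨?_, ?_⟩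
  · refine ((lock_splitting hk hp).pow 2).congr_deriv ?_
    try simp only [Nat.cast_ofNat, Nat.reduceSub, pow_one]
    ring
  · have : 0 ≤ -a * rq t := mul_nonneg (by linarith) hq
    nlinarith [sq_nonneg (rk t - rp t)]

/-- **The locked pump.** On the lock `rk t = rp t` (with `a = b`, `c = −2a`), the pair amplitude
`x = √2·rk` and the odd leg `y = rq` obey Tao's pump `x' = −α·x·y`, `y' = α·x²` with `α = −a`. -/
theorem locked_pump (hk : HasDerivAt rk (a * rp t * rq t) t)
    (hq : HasDerivAt rq (-2 * a * rk t * rp t) t) (hlock : rk t = rp t) :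
    HasDerivAt (fun s => Real.sqrt 2 * rk s) (-(-a) * (Real.sqrt 2 * rk t) * rq t) t ∧
      HasDerivAt rq ((-a) * (Real.sqrt 2 * rk t) ^ 2) t := by
  have h2 : Real.sqrt 2 ^ 2 = 2 := Real.sq_sqrt (by norm_num)
  refine ⟨?_, ?_⟩
  · refine (hk.const_mul (Real.sqrt 2)).congr_deriv ?_
    rw [hlock]; ring
  · refine hq.congr_deriv ?_
    rw [hlock, mul_pow, h2]; ring

/-- **The amplifier's lock is attracting.** In the amplifier topology the locked pair `(rk, rp)`
(`a = b`) is the OUTPUT and grows when `0 ≤ a·rq`; then `δ²` has non-positive derivative. -/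
theorem locked_amplifier_splitting (hk : HasDerivAt rk (a * rp t * rq t) t)
    (hp : HasDerivAt rp (a * rq t * rk t) t) (haq : 0 ≤ a * rq t) :
    HasDerivAt (fun s => (rk s - rp s) ^ 2) (-2 * a * rq t * (rk t - rp t) ^ 2) t ∧
      -2 * a * rq t * (rk t - rp t) ^ 2 ≤ 0 := by
  refine ⟨?_, ?_⟩
  · refine ((lock_splitting hk hp).pow 2).congr_deriv ?_
    try simp only [Nat.cast_ofNat, Nat.reduceSub, pow_one]
    ring
  · nlinarith [sq_nonneg (rk t - rp t)]

/-- **Rotor invariants.** With a silent apex (`c = 0`) and `b = −a` (energy), the apex amplitude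
`rq` and the pair energy `rk² + rp²` are conserved — Tao's rotor with driver `z = rq`. -/
theorem rotor_invariants (hk : HasDerivAt rk (a * rp t * rq t) t)
    (hp : HasDerivAt rp (-a * rq t * rk t) t) (hq : HasDerivAt rq (0 * rk t * rp t) t) :
    HasDerivAt rq 0 t ∧ HasDerivAt (fun s => rk s ^ 2 + rp s ^ 2) 0 t := by
  refine ⟨hq.congr_deriv (by ring), ?_⟩
  refine ((hk.pow 2).add (hp.pow 2)).congr_deriv ?_
  try simp only [Nat.cast_ofNat, Nat.reduceSub, pow_one]
  ring

end Dynamic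

/-! ## Thin octave shells (memo §E.2/E.3b, appended): which triads cross octaves, and which carry flux -/

section OctaveShells
variable (sk sp sq k p q : ℝ)

/-- **No triad spans three distinct octave shells** when the shells are thinner than `1/3` in
relative width: if the three moduli lie in shells `[K_a, K_a(1+δ)]`, `[K_b, K_b(1+δ)]`, `[K_c, ∞)`
with octave separation `2K_a ≤ K_b`, `2K_b ≤ K_c` and `δ < 1/3`, the triangle inequality
`q ≤ k + p` fails. Hence in the thin-octave-shell arena every inter-octave triad has two legs in the
SAME shell. -/
theorem no_three_octave_triad {Ka Kb Kc δ : ℝ} (hKa : 0 < Ka) (hab : 2 * Ka ≤ Kb) (hbc : 2 * Kb ≤ Kc)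
    (hδ : δ < 1 / 3) (hk : k ≤ Ka * (1 + δ)) (hp : p ≤ Kb * (1 + δ)) (hq : Kc ≤ q) :
    k + p < q := by
  nlinarith

/-- **Inter-octave flux is heterochiral.** For a triad with ONE low leg `k` and two legs `p, q` in
the same upper shell `[K, K(1+δ)]`: if the upper pair is HOMOCHIRAL (`sp = sq`, unit sign) the low
leg's coefficient is at most `δ·K` in size (the low leg is a near-silent apex: a rotor inside the
upper shell, no flux to leading order in `δ`) … -/
theorem low_leg_coeff_homochiral_small {K δ : ℝ} (hpK : K ≤ p) (hpK' : p ≤ K * (1 + δ))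
    (hqK : K ≤ q) (hqK' : q ≤ K * (1 + δ)) (hsp : sp = 1 ∨ sp = -1) (hhomo : sq = sp) :
    |Ck sk sp sq k p q| ≤ δ * K := by
  unfold Ck
  subst hhomo
  rcases hsp with rfl | rfl
  · rw [abs_le]; constructor <;> nlinarith
  · rw [abs_le]; constructor <;> nlinarith

/-- … whereas if the upper pair is HETEROCHIRAL (`sq = -sp`) the low leg's coefficient has size
`p + q ≥ 2K`: it is the odd-sign, largest-coefficient (unstable) leg — the parametric-decay AMPLIFIER
that carries the upward flux (memo §E.3b). -/
theorem low_leg_coeff_heterochiral_large {K : ℝ} (hpK : K ≤ p) (hqK : K ≤ q)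
    (hsp : sp = 1 ∨ sp = -1) (hhet : sq = -sp) :
    2 * K ≤ |Ck sk sp sq k p q| := by
  unfold Ck
  subst hhet
  rcases hsp with rfl | rfl
  · rw [le_abs]; right; linarith
  · rw [le_abs]; left; linarith

end OctaveShells

/-! ## The Beltrami form (memo §H.5(a), appended) -/

section BeltramiForm
variable (sk sp sq k p q : ℝ)

/-- **Beltrami (Arnold) form of a triad.** For every `λ`, the pattern conserves the quadratic form
`Q_λ = Σ_legs (s·|leg| − λ)·|a_leg|²` (helicity minus `λ` × energy):
`(sk·k − λ)Ck + (sp·p − λ)Cp + (sq·q − λ)Cq = 0`. With `λ = s|p₀|` for a Beltrami host of helicity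
`s` and modulus `|p₀|`, `Q_λ` is definite on the legs homochiral with the host at moduli `> |p₀|`
(coefficient `|leg| − |p₀| > 0`): energy can leave such a host only through the opposite-helicity
sector — the triad-level reason for the exact zeros of the 'plus' columns of P-LADDER-1. -/
theorem beltrami_form (lam : ℝ) :
    (sk * k - lam) * Ck sk sp sq k p q + (sp * p - lam) * Cp sk sp sq k p q +
      (sq * q - lam) * Cq sk sp sq k p q = 0 := by
  linear_combination pattern_helicity sk sp sq k p q - lam * pattern_energy sk sp sq k p q

/-- Sign of the Beltrami weight on a leg homochiral with the host (`s_leg = s`, unit sign) and of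
larger modulus: `s·(s·|leg| − s·|p₀|) = |leg| − |p₀| > 0`. -/
theorem beltrami_weight_pos {s m p0 : ℝ} (hs : s = 1 ∨ s = -1) (hm : p0 < m) :
    0 < s * (s * m - s * p0) := by
  rcases hs with rfl | rfl <;> nlinarith

end BeltramiForm

end Summit.NavierStokesRegularity.FluidComputer.TriadGateDictionary
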